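import Summits.QuantumFields.YangMills.Theorems.FluctuationComparisonRegPrIntLS2BetaRowTransportVariance
import Literature.MathematicalPhysics.QuantumFieldTheory.Balaban1983to89.BlockAveragingEMLProp2
import HarnessLib

/-!
# hFlat road (γ), m = 1: THE ONE-STEP MEAN LETTER — `dist1 (T_c · ū(c)⁻¹)` against Bałaban's (0.4) average, in the tree's own loop vocabulary:
# the (0.4) loop variables are bounded by RECTANGLE LEGS (diagonal staircase Stokes, word form) plus a REORDERING LOOP, and `exp[mean log]` to second order

Cell `ym3-torus` (YM ladder rung R3 = continuum `SU(2)` Yang–Mills on the three-torus — a RUNG: NOT d = 4, NOT infinite volume, NOT a mass gap, NOT Clay).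
Width seat `ym3-torus-px13` (gen 22); brick (b3) named by `ym3-torus-px12` g22 (HOME `ym3-torus-px12/g22/HFLAT-ROAD-AFTER-6.px12g22.md` §3–§5 (γ), bus 06:14:08Z):
the `m = 1` dry run of the unrolling of `ū^m` against through-face transporters.  `--kind proof --supports stmt-QuantumFields-20520 --as helper`, count-neutral,
DEFINITION-FREE (0 `def`, 0 `instance`, 0 `notation`, 0 `sorry`, default heartbeats).  Pure lattice kinematics for ANY gauge group on ANY torus of the tree's
`Params` (§1–§6); §7 for the printed average `ExpMeanLog.expMeanLogSU` on `SU(N)` (the T³ family's `ℰp` is `N = 2`).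

OBJECTS (all lit, nothing redefined): the one-step average `BlockAveraging.avgFun ℰ U c = corr ℰ U c * axialAvg U c` ([Balaban1987RG1] (0.4)), its loop variables
`BlockAveraging.loopHol U c (r, σ, σ′) = U(Γ^σ_{c₋→x} ∪ [x,x′] ∪ (−Γ^{σ′}_{c₊→x′}) ∪ (−c))` over `Idx P = (Fin d → Fin L) × Perm × Perm` (offsets `off r`, INDEPENDENT run
orders `σ, σ′` at the two ends), the straight row `T_c = axialAvg U c = rowProd U (emb c₋) μ L`, rectangles `B10Eq47AxialChi.rect`.

WHAT.
* §1 words ↔ rows (`holAt_walk_replicate_false`, `walkEnd_shiftN`, `holAt_walk_axisRun_of_nonneg∕_of_neg`); §2 one leg sweeps one rectangle (`dist1_oneLeg_fwd∕bwd`).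
* §3 ★ `dist1_stairLoop_le_sum_rect` — DIAGONAL STAIRCASE STOKES, WORD FORM: the loop «staircase `stairRuns n as` from `x`, row `μ^N`, translated staircase back, row back»
  has `dist1 ≤ Σ_{i<|as|} dist1 U(∂R_i)`, `R_i` the `N × |n(as_i)|` rectangle in the `(μ, as_i)`-plane at the LOWER corner of leg `i` (induction on `as`: conjugate of the
  tail loop × the one-leg loop; the word-level twin of ✓px21 g21 `…KLegStaircaseStokes.dist1_stairCompare_le_sum_rect`, which is stated over `rowProd` data).
* §4 ★ `dist1_loopHol_diag_le_sum_rect` — the DIAGONAL loop variable `W_{r,σ,σ}` (lit ✓`loopHol_eq`) IS §3's loop: `dist1 W_{r,σ,σ} ≤ Σ_{k<d} dist1 U(∂R_k(r,σ))`.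
* §5 ★ `dist1_loopHol_le_diag_add_reorder` — EXACT REDUCTION `dist1 W_{r,σ,σ′} ≤ dist1 W_{r,σ,σ} + dist1 (U(Γ^σ_{c₊}) U(Γ^{σ′}_{c₊})⁻¹)` (the REORDERING LOOP: two
  staircases with the same endpoints inside the far block; `reorder_eq_holAt_append` writes it as ONE closed word); ★★ `sum_dist1_loopHol_le` — the sum over `Idx P`.
* §6 `axialAvg_mul_avgFun_inv` (`T_c · ū(c)⁻¹ = κ_c⁻¹`), `dist1_axialAvg_mul_avgFun_inv`.
* §7 (`SU(N)`, `exp[mean log]`): `dist1_corr_le_mean_add_sq` (`dist1 κ_c ≤ |I|⁻¹Σᵢ dist1 Wᵢ + 6θ²`, lit ✓`BlockAveragingEMLProp2.norm_corr_sub_mean_le`),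
  ★ `dist1_corr_le_lin_sum` (CHARGEABLE edition with the local max: `≤ (|I|⁻¹ + 6θ)·Σᵢ dist1 Wᵢ`, px12 06:20Z (2)), and THE LETTER
  ★★★ `dist1_axialAvg_mul_avgFun_inv_le_lin_legs : dist1 (T_c · ū(c)⁻¹) ≤ (|I|⁻¹ + 6θ) · Σ_{(r,σ,σ′)} (Σ_{k<d} dist1 U(∂R_k(r,σ)) + dist1 REORDER(r,σ,σ′))`
  under `dist1 Wᵢ ≤ θ < δ_N`, `θ ≤ ¼` (from `PlaqSmall δ U` take `θ = (((d+2)L)²∕4)·δ`, lit ✓`LatticeWordStokes.dist1_loopHol_le`).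

LEFT TO THE LANE (named, NOT proved here): (R) the ℓ¹ Stokes of the REORDERING LOOP `U(Γ^σ ∪ (−Γ^{σ′}))` (one explicit plaquette per adjacent letter swap of the bubble
sort `σ′ → σ`, lit ✓`LatticeWordStokes.holAt_walk_swap_eq`) — it appears here only as an explicit holonomy term; (γ)-lite's MULTIPLICATIVE `(1 + Cθ)` edition of §7
(px8 g21 `…S2BetaExpMeanLogLipschitz`) composes with ✓`sum_dist1_loopHol_le` verbatim; the weights `π′` of px12's count are read off the explicit corners of §4∕§7.

HONEST: kinematics (subadditivity ∕ conjugation invariance of `dist1`, list induction) + one cited second-order estimate; nothing of Bałaban's analysis; hFlat, TUBE-REG∘,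
GAP♯∘, EXW∘, S2β, crux 20520 NOT proved; no registered stub closed; rung R3 = SU(2) YM₃ on T³ — NOT d = 4, NOT infinite volume, NOT a mass gap, NOT Clay; the Yang–Mills
mass gap is NOT proved.  Sorry-free, axioms standard.

References: T. Bałaban, CMP **109** (1987) 249–301 [Balaban1987RG1] ((0.3)–(0.4) pp.252–253); CMP **98** (1985) 17–51 [Balaban1985Averaging] ((9) p.19, (19)–(21)
pp.21–22, (26)–(27) p.22); CMP **99** (1985) 75–102 [Balaban1985RegularSpaces] (Lemma 1 p.79); CMP **96** (1984) 223–250 [Balaban1984PropagatorsII] ((1.33)).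
-/

set_option autoImplicit false

noncomputable section

namespace Summit.QuantumFields.YangMills.Theorems.FluctuationComparisonRegPrIntLS2BetaOneStepMeanLetter

open Finset
open Literature.MathematicalPhysics.QuantumFieldTheory.Balaban1983to89
open T4Continuum
open B10Eq47AxialChi (shiftN shiftN_zero shiftN_succ rowProd rowProd_zero rowProd_succ rect)
open BlockAveragingEMLProp2 (walkEnd_replicate_true holAt_walk_replicate_true emb_shift_eq_shiftN loopHol_eq)
open Summit.QuantumFields.YangMills.Theorems.FluctuationComparisonRegPrIntLS2BetaRowTransportVariance (shiftN_comm shiftN_add rect_swap)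

variable {P : Params} {j : ℕ} {G : Type*} [GaugeGroup G]

/-! ## §1 Words ↔ straight rows -/

/-- Walking `m` steps `−e_μ` from `x + m e_μ` transports by the INVERSE of the straight row from `x`. [cite: Balaban1985Averaging, (9) p.19, (19) p.21] -/
theorem holAt_walk_replicate_false (U : GaugeField P j G) (x : Site P j) (μ : Fin P.d) (m : ℕ) :
    holAt U (walk (shiftN x μ m) (List.replicate m (μ, false))) = (rowProd U x μ m)⁻¹ := by
  have h : List.replicate m ((μ, false) : Letter P.d) = wordRev (List.replicate m (μ, true)) := by
    rw [wordRev_replicate]; rfl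
  rw [← walkEnd_replicate_true x μ m, h, holAt_walk_wordRev, holAt_walk_replicate_true]

/-- The end of the backward straight walk: `(x + m e_μ) − m e_μ = x`. [folklore] -/
theorem walkEnd_replicate_false (x : Site P j) (μ : Fin P.d) (m : ℕ) :
    walkEnd (shiftN x μ m) (List.replicate m (μ, false)) = x := by
  have h : List.replicate m ((μ, false) : Letter P.d) = wordRev (List.replicate m (μ, true)) := by
    rw [wordRev_replicate]; rfl
  rw [← walkEnd_replicate_true x μ m, h, walkEnd_walkEnd_wordRev]

/-- Translation by `N e_μ` commutes with walking a word. [folklore] -/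
theorem walkEnd_shiftN (x : Site P j) (μ : Fin P.d) (N : ℕ) (w : List (Letter P.d)) :
    walkEnd (shiftN x μ N) w = shiftN (walkEnd x w) μ N := by
  funext κ
  rw [walkEnd_apply, BlockAveragingEMLProp2.shiftN_apply, BlockAveragingEMLProp2.shiftN_apply, walkEnd_apply]
  ring

/-- A NONNEGATIVE axis run is the straight row: holonomy and end. [cite: Balaban1987RG1, (0.3) p.252] -/
theorem holAt_walk_axisRun_of_nonneg (U : GaugeField P j G) (x : Site P j) (a : Fin P.d) {k : ℤ} (hk : 0 ≤ k) :
    holAt U (walk x (axisRun a k)) = rowProd U x a k.natAbs ∧ walkEnd x (axisRun a k) = shiftN x a k.natAbs := by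
  have h : axisRun a k = List.replicate k.natAbs (a, true) := by simp [axisRun, hk]
  rw [h, holAt_walk_replicate_true, walkEnd_replicate_true]
  exact ⟨rfl, rfl⟩

/-- A NEGATIVE axis run is the inverse straight row read from its END: `x = end + |k| e_a`. [cite: Balaban1987RG1, (0.3) p.252] -/
theorem holAt_walk_axisRun_of_neg (U : GaugeField P j G) (x : Site P j) (a : Fin P.d) {k : ℤ} (hk : k < 0) :
    shiftN (walkEnd x (axisRun a k)) a k.natAbs = x ∧
      holAt U (walk x (axisRun a k)) = (rowProd U (walkEnd x (axisRun a k)) a k.natAbs)⁻¹ := by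
  have h : axisRun a k = List.replicate k.natAbs (a, false) := by simp [axisRun, not_le.mpr hk]
  have hx : shiftN (walkEnd x (axisRun a k)) a k.natAbs = x := by
    funext κ
    rw [BlockAveragingEMLProp2.shiftN_apply, walkEnd_apply, netDisp_axisRun]
    by_cases hκ : a = κ
    · subst hκ
      have hz : ((k.natAbs : ℕ) : ℤ) = -k := Int.ofNat_natAbs_of_nonpos hk.le
      have e : ((k.natAbs : ℕ) : ZMod (P.sitesPerDir j)) = -((k : ℤ) : ZMod (P.sitesPerDir j)) := by
        have h2 := congrArg (Int.cast : ℤ → ZMod (P.sitesPerDir j)) hz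
        simpa using h2
      simp only [if_true]
      rw [e]; abel
    · simp [hκ, Ne.symm hκ]
  refine ⟨hx, ?_⟩
  conv_lhs => rw [← hx]
  rw [h, holAt_walk_replicate_false]

/-! ## §2 One leg of a staircase sweeps one rectangle -/

/-- **FORWARD LEG**: for `k ≥ 0`, `κ = |k|`, the one-leg loop «run `a^k` from `x`, row `μ^N`, back along the translated run, back along the row at `x`» IS the
`κ × N` rectangle holonomy in the `(a, μ)`-plane based at `x`; its `dist1` is that of the `N × κ` rectangle `rect U x μ a N κ` (orientation swap = inversion).
[cite: Balaban1985Averaging, (9) p.19, (19) p.21] -/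
theorem dist1_oneLeg_fwd (U : GaugeField P j G) (x : Site P j) (μ a : Fin P.d) (N κ : ℕ) :
    dist1 (rowProd U x a κ * rowProd U (shiftN x a κ) μ N * (rowProd U (shiftN x μ N) a κ)⁻¹ * (rowProd U x μ N)⁻¹) =
      dist1 (rect U x μ a N κ) := by
  rw [rect_swap U x μ a N κ, GaugeGroup.dist1_inv]
  rfl

/-- **BACKWARD LEG**: for `k < 0`, `κ = |k|`, `x = x₁ + κ e_a`, the one-leg loop «inverse run from `x` down to `x₁`, row at `x₁`, translated run up, back along the row at
`x`» is the conjugate by `(rowProd U x₁ a κ)⁻¹` of the `N × κ` rectangle `rect U x₁ μ a N κ` based at the LOWER corner `x₁`. [cite: Balaban1985Averaging, (9) p.19, (19) p.21] -/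
theorem dist1_oneLeg_bwd (U : GaugeField P j G) (x₁ : Site P j) (μ a : Fin P.d) (N κ : ℕ) :
    dist1 ((rowProd U x₁ a κ)⁻¹ * rowProd U x₁ μ N * ((rowProd U (shiftN x₁ μ N) a κ)⁻¹)⁻¹ * (rowProd U (shiftN x₁ a κ) μ N)⁻¹) =
      dist1 (rect U x₁ μ a N κ) := by
  have e : (rowProd U x₁ a κ)⁻¹ * rowProd U x₁ μ N * ((rowProd U (shiftN x₁ μ N) a κ)⁻¹)⁻¹ * (rowProd U (shiftN x₁ a κ) μ N)⁻¹ =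
      (rowProd U x₁ a κ)⁻¹ * rect U x₁ μ a N κ * ((rowProd U x₁ a κ)⁻¹)⁻¹ := by
    unfold rect; group
  rw [e, GaugeGroup.dist1_conj]

/-! ## §3 The DIAGONAL staircase loop: two parallel rows compared along the SAME staircase at both ends (word form of ✓px21 (iii)) -/

/-- ★ **DIAGONAL STAIRCASE STOKES, WORD FORM** (any gauge group, any torus, any axis list `as`, any offsets `n`): the loop «staircase `Γ = stairRuns n as` from `x`, the
straight row of `N` steps `+e_μ` from its end, the TRANSLATED staircase backwards, the row at `x` backwards» satisfies
`dist1 ≤ Σ_{i < |as|} dist1 U(∂R_i)`, `R_i` the `N × |n(as_i)|` rectangle in the `(μ, as_i)`-plane based at the LOWER corner of leg `i` (the corner before the leg if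
`n(as_i) ≥ 0`, after it if `n(as_i) < 0`; corners = `walkEnd x (stairRuns n (as.take i))`).  Induction on `as`: the loop is the conjugate of the loop of the tail (from the
first corner) times the one-leg loop of §2 ([Balaban1985Averaging] (19): `|XY − 1| ≤ |X − 1| + |Y − 1|`, unitary invariance). [cite: Balaban1985Averaging, (9) p.19, (19)-(20) p.21; Balaban1987RG1, (0.3) p.252] -/
theorem dist1_stairLoop_le_sum_rect (U : GaugeField P j G) (μ : Fin P.d) (N : ℕ) (n : Fin P.d → ℤ) :
    ∀ (as : List (Fin P.d)) (x : Site P j),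
      dist1 (holAt U (walk x (stairRuns n as)) * rowProd U (walkEnd x (stairRuns n as)) μ N *
          (holAt U (walk (shiftN x μ N) (stairRuns n as)))⁻¹ * (rowProd U x μ N)⁻¹) ≤
        ((List.range as.length).map fun i =>
          dist1 (rect U (if 0 ≤ n (as.getD i μ) then walkEnd x (stairRuns n (as.take i)) else walkEnd x (stairRuns n (as.take (i + 1))))
            μ (as.getD i μ) N (n (as.getD i μ)).natAbs)).sum
  | [], x => by
    simp [stairRuns, walk, walkEnd, holAt_nil, GaugeGroup.dist1_one]
  | a :: as, x => by
    -- split the first run off the staircase, at both ends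
    have hsr : stairRuns n (a :: as) = axisRun a (n a) ++ stairRuns n as := rfl
    set x₁ := walkEnd x (axisRun a (n a)) with hx₁
    have hnear : holAt U (walk x (stairRuns n (a :: as))) = holAt U (walk x (axisRun a (n a))) * holAt U (walk x₁ (stairRuns n as)) := by
      rw [hsr, walk_append, holAt_append]
    have hend : walkEnd x (stairRuns n (a :: as)) = walkEnd x₁ (stairRuns n as) := by rw [hsr, walkEnd_append]
    have hfar : holAt U (walk (shiftN x μ N) (stairRuns n (a :: as))) =
        holAt U (walk (shiftN x μ N) (axisRun a (n a))) * holAt U (walk (shiftN x₁ μ N) (stairRuns n as)) := by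
      rw [hsr, walk_append, holAt_append, walkEnd_shiftN]
    -- the telescope identity
    set hA := holAt U (walk x (axisRun a (n a))) with hhA
    set hA' := holAt U (walk (shiftN x μ N) (axisRun a (n a))) with hhA'
    set hR := holAt U (walk x₁ (stairRuns n as)) with hhR
    set hR' := holAt U (walk (shiftN x₁ μ N) (stairRuns n as)) with hhR'
    have e : hA * hR * rowProd U (walkEnd x₁ (stairRuns n as)) μ N * (hA' * hR')⁻¹ * (rowProd U x μ N)⁻¹ =
        hA * (hR * rowProd U (walkEnd x₁ (stairRuns n as)) μ N * hR'⁻¹ * (rowProd U x₁ μ N)⁻¹) * hA⁻¹ *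
          (hA * rowProd U x₁ μ N * hA'⁻¹ * (rowProd U x μ N)⁻¹) := by
      group
    rw [hnear, hend, hfar, e]
    refine (GaugeGroup.dist1_mul_le _ _).trans ?_
    rw [GaugeGroup.dist1_conj]
    -- the right-hand side: first term + shifted tail
    rw [List.length_cons, List.range_succ_eq_map, List.map_cons, List.map_map, List.sum_cons]
    have htail : ((List.range as.length).map ((fun i =>
          dist1 (rect U (if 0 ≤ n ((a :: as).getD i μ) then walkEnd x (stairRuns n ((a :: as).take i))
            else walkEnd x (stairRuns n ((a :: as).take (i + 1)))) μ ((a :: as).getD i μ) N (n ((a :: as).getD i μ)).natAbs)) ∘ Nat.succ)).sum =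
        ((List.range as.length).map fun i =>
          dist1 (rect U (if 0 ≤ n (as.getD i μ) then walkEnd x₁ (stairRuns n (as.take i)) else walkEnd x₁ (stairRuns n (as.take (i + 1))))
            μ (as.getD i μ) N (n (as.getD i μ)).natAbs)).sum := by
      congr 1
      refine List.map_congr_left fun i _ => ?_
      simp only [Function.comp, Nat.succ_eq_add_one, List.getD_cons_succ, List.take_succ_cons]
      rw [show stairRuns n (a :: as.take i) = axisRun a (n a) ++ stairRuns n (as.take i) from rfl,
        show stairRuns n (a :: as.take (i + 1)) = axisRun a (n a) ++ stairRuns n (as.take (i + 1)) from rfl,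
        walkEnd_append, walkEnd_append]
    rw [htail]
    -- the one-leg term equals the head summand
    have hB : dist1 (hA * rowProd U x₁ μ N * hA'⁻¹ * (rowProd U x μ N)⁻¹) =
        dist1 (rect U (if 0 ≤ n ((a :: as).getD 0 μ) then walkEnd x (stairRuns n ((a :: as).take 0))
            else walkEnd x (stairRuns n ((a :: as).take (0 + 1)))) μ ((a :: as).getD 0 μ) N (n ((a :: as).getD 0 μ)).natAbs) := by
      have hg : (a :: as).getD 0 μ = a := rfl
      have ht0 : walkEnd x (stairRuns n ((a :: as).take 0)) = x := rfl
      have ht1 : walkEnd x (stairRuns n ((a :: as).take (0 + 1))) = x₁ := by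
        rw [zero_add, List.take_succ_cons, List.take_zero, show stairRuns n [a] = axisRun a (n a) ++ [] from rfl, List.append_nil]
      rw [hg, ht0, ht1]
      rcases le_or_gt 0 (n a) with hk | hk
      · obtain ⟨h1, h2⟩ := holAt_walk_axisRun_of_nonneg U x a hk
        obtain ⟨h1', -⟩ := holAt_walk_axisRun_of_nonneg U (shiftN x μ N) a hk
        rw [if_pos hk, hhA, hhA', h1, h1', hx₁, h2]
        exact dist1_oneLeg_fwd U x μ a N (n a).natAbs
      · obtain ⟨h1, h2⟩ := holAt_walk_axisRun_of_neg U x a hk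
        obtain ⟨-, h2'⟩ := holAt_walk_axisRun_of_neg U (shiftN x μ N) a hk
        rw [if_neg (not_le.mpr hk), hhA, hhA', h2, h2', walkEnd_shiftN, ← hx₁]
        conv_lhs => rw [← h1, ← hx₁]
        exact dist1_oneLeg_bwd U x₁ μ a N (n a).natAbs
    calc dist1 (hR * rowProd U (walkEnd x₁ (stairRuns n as)) μ N * hR'⁻¹ * (rowProd U x₁ μ N)⁻¹) +
          dist1 (hA * rowProd U x₁ μ N * hA'⁻¹ * (rowProd U x μ N)⁻¹)
        ≤ ((List.range as.length).map fun i =>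
            dist1 (rect U (if 0 ≤ n (as.getD i μ) then walkEnd x₁ (stairRuns n (as.take i)) else walkEnd x₁ (stairRuns n (as.take (i + 1))))
              μ (as.getD i μ) N (n (as.getD i μ)).natAbs)).sum +
          dist1 (rect U (if 0 ≤ n ((a :: as).getD 0 μ) then walkEnd x (stairRuns n ((a :: as).take 0))
            else walkEnd x (stairRuns n ((a :: as).take (0 + 1)))) μ ((a :: as).getD 0 μ) N (n ((a :: as).getD 0 μ)).natAbs) :=
          add_le_add (dist1_stairLoop_le_sum_rect U μ N n as x₁) hB.le
      _ = _ := add_comm _ _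

/-! ## §4 The DIAGONAL (0.4) loop variable `W_{r,σ,σ}` at a coarse bond, bounded by its `d` rectangle legs -/

/-- The straight coarse-bond transporter `U(c)` (tree `AveragingRT.axialAvg`) is the straight row of `L` steps from the block centre. [cite: Balaban1985Averaging, (9)-(10) p.19] -/
theorem axialAvg_eq_rowProd (U : GaugeField P j G) (c : PBond P (j + 1)) :
    AveragingRT.axialAvg U c = rowProd U (emb c.src) c.dir P.L := by
  rw [axialAvg_eq_holAt_walk, holAt_walk_replicate_true]

/-- ★ **THE DIAGONAL LOOP VARIABLE OF (0.4) IS BOUNDED BY ITS `d` RECTANGLE LEGS** (any gauge group, any torus, any member geometry): for the index `(r, σ, σ)` — the SAME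
ordering `σ` for the near staircase `Γ ∈ G(c₋, x)` and the far one `Γ′ ∈ G(c₊, x′)` — the loop variable `U(Γ ∪ [x,x′] ∪ (−Γ′) ∪ (−c))` is §3's diagonal staircase loop from
`emb c₋` (`U(c)` = the straight row, `emb c₊ = emb c₋ + L e_μ`), hence `dist1 ≤ Σ_{i<d}` `dist1` of the `L × |n_{σ(i)}|` rectangle in the `(μ, σ(i))`-plane at the lower corner of
leg `i` of the staircase with offsets `n = off r`. [cite: Balaban1987RG1, (0.3)-(0.4) pp.252-253; Balaban1985Averaging, (9) p.19, (19)-(20) p.21] -/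
theorem dist1_loopHol_diag_le_sum_rect (U : GaugeField P j G) (c : PBond P (j + 1)) (r : Fin P.d → Fin P.L) (σ : Equiv.Perm (Fin P.d)) :
    dist1 (BlockAveraging.loopHol U c (r, σ, σ)) ≤
      ((List.range P.d).map fun i =>
        dist1 (rect U
          (if 0 ≤ BlockAveraging.off r (((List.finRange P.d).map σ).getD i c.dir)
            then walkEnd (emb c.src) (stairRuns (BlockAveraging.off r) (((List.finRange P.d).map σ).take i))
            else walkEnd (emb c.src) (stairRuns (BlockAveraging.off r) (((List.finRange P.d).map σ).take (i + 1))))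
          c.dir (((List.finRange P.d).map σ).getD i c.dir) P.L (BlockAveraging.off r (((List.finRange P.d).map σ).getD i c.dir)).natAbs)).sum := by
  have hlen : ((List.finRange P.d).map σ).length = P.d := by simp
  have h := dist1_stairLoop_le_sum_rect U c.dir P.L (BlockAveraging.off r) ((List.finRange P.d).map σ) (emb c.src)
  rw [hlen] at h
  refine le_trans (le_of_eq ?_) h
  rw [loopHol_eq, holAt_walk_replicate_true, axialAvg_eq_rowProd, show c.tgt = c.src.shift c.dir from rfl, emb_shift_eq_shiftN]
  rfl

/-! ## §5 A general index `(r, σ, σ′)`: the diagonal loop plus the REORDERING loop in the far block -/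

/-- ★ **EXACT REDUCTION TO «DIAGONAL + REORDERING»**: for independent orderings `σ` (near) and `σ′` (far) of the (0.4) staircases,
`dist1 W_{r,σ,σ′} ≤ dist1 W_{r,σ,σ} + dist1 (U(Γ^σ_{c₊→x′}) · U(Γ^{σ′}_{c₊→x′})⁻¹)` — the second term is the holonomy of the closed REORDERING LOOP at `emb c₊` (two staircases
with the same endpoints and different run orders), read inside the far block; `W_{r,σ,σ′} = W_{r,σ,σ} · [U(c) · (U(Γ^σ) U(Γ^{σ′})⁻¹) · U(c)⁻¹]` (lit ✓`loopHol_eq`), subadditivity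
and conjugation invariance of `dist1`. [cite: Balaban1987RG1, (0.3)-(0.4) pp.252-253; Balaban1985Averaging, (19)-(20) p.21] -/
theorem dist1_loopHol_le_diag_add_reorder (U : GaugeField P j G) (c : PBond P (j + 1)) (r : Fin P.d → Fin P.L) (σ σ' : Equiv.Perm (Fin P.d)) :
    dist1 (BlockAveraging.loopHol U c (r, σ, σ')) ≤
      dist1 (BlockAveraging.loopHol U c (r, σ, σ)) +
        dist1 (holAt U (walk (emb c.tgt) (stairWord σ (BlockAveraging.off r))) * (holAt U (walk (emb c.tgt) (stairWord σ' (BlockAveraging.off r))))⁻¹) := by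
  rw [loopHol_eq, loopHol_eq]
  set A := holAt U (walk (emb c.src) (stairWord σ (BlockAveraging.off r)))
  set B := holAt U (walk (walkEnd (emb c.src) (stairWord σ (BlockAveraging.off r))) (List.replicate P.L (c.dir, true)))
  set C := holAt U (walk (emb c.tgt) (stairWord σ (BlockAveraging.off r)))
  set C' := holAt U (walk (emb c.tgt) (stairWord σ' (BlockAveraging.off r)))
  set T := AveragingRT.axialAvg U c
  have e : A * B * C'⁻¹ * T⁻¹ = (A * B * C⁻¹ * T⁻¹) * (T * (C * C'⁻¹) * T⁻¹) := by group
  -- `(r, σ, σ').2.1 = σ` etc. are definitional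
  show dist1 (A * B * C'⁻¹ * T⁻¹) ≤ dist1 (A * B * C⁻¹ * T⁻¹) + dist1 (C * C'⁻¹)
  rw [e]
  exact (GaugeGroup.dist1_mul_le _ _).trans (by rw [GaugeGroup.dist1_conj])

/-- The reordering term as ONE closed word at `emb c₊`: `U(Γ^σ) · U(Γ^{σ′})⁻¹ = U(Γ^σ ∪ (−Γ^{σ′}))` (the two staircases end at the same site, lit ✓`walkEnd_stairWord_eq`).
[cite: Balaban1987RG1, (0.3) p.252; Balaban1985Averaging, (19) p.21] -/
theorem reorder_eq_holAt_append (U : GaugeField P j G) (y : Site P j) (σ σ' : Equiv.Perm (Fin P.d)) (n : Fin P.d → ℤ) :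
    holAt U (walk y (stairWord σ n)) * (holAt U (walk y (stairWord σ' n)))⁻¹ =
      holAt U (walk y (stairWord σ n ++ wordRev (stairWord σ' n))) := by
  rw [walk_append, holAt_append, BlockAveragingEMLProp2.walkEnd_stairWord_eq y σ σ' n, holAt_walk_wordRev]

/-- ★★ **THE SUM OF ALL (0.4) LOOP VARIABLES AT A COARSE BOND, BOUNDED BY RECTANGLE LEGS AND REORDERING LOOPS** (any gauge group): summing §5 over the index set
`Idx P = (Fin d → Fin L) × Perm × Perm` of the double average. [cite: Balaban1987RG1, (0.4) p.253; Balaban1985Averaging, (19)-(20) p.21] -/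
theorem sum_dist1_loopHol_le (U : GaugeField P j G) (c : PBond P (j + 1)) :
    ∑ i : BlockAveraging.Idx P, dist1 (BlockAveraging.loopHol U c i) ≤
      ∑ i : BlockAveraging.Idx P,
        (((List.range P.d).map fun k =>
          dist1 (rect U
            (if 0 ≤ BlockAveraging.off i.1 (((List.finRange P.d).map i.2.1).getD k c.dir)
              then walkEnd (emb c.src) (stairRuns (BlockAveraging.off i.1) (((List.finRange P.d).map i.2.1).take k))
              else walkEnd (emb c.src) (stairRuns (BlockAveraging.off i.1) (((List.finRange P.d).map i.2.1).take (k + 1))))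
            c.dir (((List.finRange P.d).map i.2.1).getD k c.dir) P.L (BlockAveraging.off i.1 (((List.finRange P.d).map i.2.1).getD k c.dir)).natAbs)).sum +
        dist1 (holAt U (walk (emb c.tgt) (stairWord i.2.1 (BlockAveraging.off i.1) ++ wordRev (stairWord i.2.2 (BlockAveraging.off i.1)))))) := by
  refine Finset.sum_le_sum fun i _ => ?_
  obtain ⟨r, σ, σ'⟩ := i
  refine (dist1_loopHol_le_diag_add_reorder U c r σ σ').trans (add_le_add (dist1_loopHol_diag_le_sum_rect U c r σ) (le_of_eq ?_))
  rw [reorder_eq_holAt_append]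

/-! ## §6 The algebra of the mean letter: `T_c · ū(c)⁻¹ = κ_c⁻¹` (any small-loop average `ℰ`) -/

/-- **`T_c · ū(c)⁻¹ = κ_c⁻¹`**: `ū(c) = avgFun ℰ U c = κ_c · U(c)` (lit `BlockAveraging.avgFun`), `T_c = U(c)` the straight row. [cite: Balaban1987RG1, (0.4) p.253] -/
theorem axialAvg_mul_avgFun_inv (ℰ : LoopAverage G) (U : GaugeField P j G) (c : PBond P (j + 1)) :
    AveragingRT.axialAvg U c * (BlockAveraging.avgFun ℰ U c)⁻¹ = (BlockAveraging.corr ℰ U c)⁻¹ := by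
  unfold BlockAveraging.avgFun
  group

/-- Hence `dist1 (T_c · ū(c)⁻¹) = dist1 κ_c`. [cite: Balaban1987RG1, (0.4) p.253; Balaban1985Averaging, (20) p.21] -/
theorem dist1_axialAvg_mul_avgFun_inv (ℰ : LoopAverage G) (U : GaugeField P j G) (c : PBond P (j + 1)) :
    dist1 (AveragingRT.axialAvg U c * (BlockAveraging.avgFun ℰ U c)⁻¹) = dist1 (BlockAveraging.corr ℰ U c) := by
  rw [axialAvg_mul_avgFun_inv, GaugeGroup.dist1_inv]

end Summit.QuantumFields.YangMills.Theorems.FluctuationComparisonRegPrIntLS2BetaOneStepMeanLetter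

/-! ## §7 The printed average `exp[mean log]` on `SU(N)`: the one-step MEAN LETTER -/

namespace Summit.QuantumFields.YangMills.Theorems.FluctuationComparisonRegPrIntLS2BetaOneStepMeanLetter

open Finset
open Literature.MathematicalPhysics.QuantumFieldTheory.Balaban1983to89
open T4Continuum ExpMeanLog
open B10Eq47AxialChi (shiftN rowProd rect)
open scoped Matrix.Norms.L2Operator

variable {n : Type*} [Fintype n] [DecidableEq n] [Nonempty n] {P : Params} {j : ℕ}

/-- **THE CORRECTION FACTOR IS BOUNDED BY THE MEAN OF THE LOOP DEFECTS, TO SECOND ORDER** (lit ✓`norm_corr_sub_mean_le`): if every (0.4) loop variable at `c` has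
`dist1 ≤ θ` with `θ < δ_N`, `θ ≤ ¼`, then `dist1 κ_c ≤ |I|⁻¹ Σᵢ dist1 Wᵢ + 6θ²` (`κ_c = corr ℰp U c`, `Wᵢ = loopHol U c i`, `I = Idx P`).
[cite: Balaban1987RG1, (0.4) p.253; Balaban1985Averaging, (21) p.22, (26)-(27) p.22] -/
theorem dist1_corr_le_mean_add_sq (U : GaugeField P j (Matrix.specialUnitaryGroup n ℂ)) (c : PBond P (j + 1)) {θ : ℝ}
    (hθ : ∀ i, dist1 (BlockAveraging.loopHol U c i) ≤ θ) (hθδ : θ < deltaSU n) (hθ4 : θ ≤ 1 / 4) :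
    dist1 (BlockAveraging.corr (expMeanLogSU (n := n)) U c) ≤
      (Fintype.card (BlockAveraging.Idx P) : ℝ)⁻¹ * ∑ i, dist1 (BlockAveraging.loopHol U c i) + 6 * θ ^ 2 := by
  have h1 := BlockAveragingEMLProp2.norm_corr_sub_mean_le U c hθ hθδ hθ4
  set κ : Matrix n n ℂ := ((BlockAveraging.corr (expMeanLogSU (n := n)) U c : Matrix.specialUnitaryGroup n ℂ) : Matrix n n ℂ)
  set M : Matrix n n ℂ := ((Fintype.card (BlockAveraging.Idx P) : ℂ))⁻¹ •
    ∑ i, (((BlockAveraging.loopHol U c i : Matrix.specialUnitaryGroup n ℂ) : Matrix n n ℂ) - 1)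
  have hM : ‖M‖ ≤ (Fintype.card (BlockAveraging.Idx P) : ℝ)⁻¹ * ∑ i, dist1 (BlockAveraging.loopHol U c i) := by
    have hc : ‖((Fintype.card (BlockAveraging.Idx P) : ℂ))⁻¹‖ = (Fintype.card (BlockAveraging.Idx P) : ℝ)⁻¹ := by
      rw [norm_inv, Complex.norm_natCast]
    calc ‖M‖ ≤ ‖((Fintype.card (BlockAveraging.Idx P) : ℂ))⁻¹‖ *
          ‖∑ i, (((BlockAveraging.loopHol U c i : Matrix.specialUnitaryGroup n ℂ) : Matrix n n ℂ) - 1)‖ := norm_smul_le _ _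
      _ ≤ (Fintype.card (BlockAveraging.Idx P) : ℝ)⁻¹ * ∑ i, dist1 (BlockAveraging.loopHol U c i) := by
          rw [hc]
          refine mul_le_mul_of_nonneg_left ((norm_sum_le _ _).trans (le_of_eq ?_)) (inv_nonneg.mpr (Nat.cast_nonneg _))
          rfl
  rw [FederbushMean.dist1_SU_eq]
  have e : κ - 1 = (κ - 1 - M) + M := by abel
  rw [e]
  calc ‖κ - 1 - M + M‖ ≤ ‖κ - 1 - M‖ + ‖M‖ := norm_add_le _ _
    _ ≤ 6 * θ ^ 2 + (Fintype.card (BlockAveraging.Idx P) : ℝ)⁻¹ * ∑ i, dist1 (BlockAveraging.loopHol U c i) := add_le_add h1 hM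
    _ = _ := add_comm _ _

/-- ★ **THE CHARGEABLE (MULTIPLICATIVE) EDITION** (px12 g22 06:20:47Z (2)): with the LOCAL maximum `θ_c = maxᵢ dist1 Wᵢ ≤ Σᵢ dist1 Wᵢ` in place of `θ` in the second-order
term, `6θ_c² ≤ 6θ·Σᵢ dist1 Wᵢ`, so `dist1 κ_c ≤ (|I|⁻¹ + 6θ)·Σᵢ dist1 Wᵢ = (1 + 6θ|I|)·|I|⁻¹Σᵢ dist1 Wᵢ` — no bare additive constant (every term is chargeable to loop defects,
hence to the action).  Sharper two-family letters: ✓px8 g21 `…S2BetaExpMeanLogLipschitz`. [cite: Balaban1987RG1, (0.4) p.253; Balaban1985Averaging, (21) p.22, (26)-(27) p.22] -/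
theorem dist1_corr_le_lin_sum (U : GaugeField P j (Matrix.specialUnitaryGroup n ℂ)) (c : PBond P (j + 1)) {θ : ℝ}
    (hθ : ∀ i, dist1 (BlockAveraging.loopHol U c i) ≤ θ) (hθδ : θ < deltaSU n) (hθ4 : θ ≤ 1 / 4) :
    dist1 (BlockAveraging.corr (expMeanLogSU (n := n)) U c) ≤
      ((Fintype.card (BlockAveraging.Idx P) : ℝ)⁻¹ + 6 * θ) * ∑ i, dist1 (BlockAveraging.loopHol U c i) := by
  set M : ℝ := Finset.univ.sup' Finset.univ_nonempty (fun i : BlockAveraging.Idx P => dist1 (BlockAveraging.loopHol U c i)) with hMdef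
  have hle : ∀ i, dist1 (BlockAveraging.loopHol U c i) ≤ M := fun i => Finset.le_sup' (fun i => dist1 (BlockAveraging.loopHol U c i)) (Finset.mem_univ i)
  have hMθ : M ≤ θ := Finset.sup'_le _ _ fun i _ => hθ i
  obtain ⟨i₀, -, hi₀⟩ := Finset.exists_mem_eq_sup' Finset.univ_nonempty (fun i : BlockAveraging.Idx P => dist1 (BlockAveraging.loopHol U c i))
  have hM0 : 0 ≤ M := (GaugeGroup.dist1_nonneg _).trans (hle i₀)
  have hMS : M ≤ ∑ i, dist1 (BlockAveraging.loopHol U c i) := by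
    rw [hMdef, hi₀]
    exact Finset.single_le_sum (fun i _ => GaugeGroup.dist1_nonneg _) (Finset.mem_univ i₀)
  have hS0 : 0 ≤ ∑ i, dist1 (BlockAveraging.loopHol U c i) := Finset.sum_nonneg fun _ _ => GaugeGroup.dist1_nonneg _
  have h := dist1_corr_le_mean_add_sq U c hle (hMθ.trans_lt hθδ) (hMθ.trans hθ4)
  have h2 : 6 * M ^ 2 ≤ 6 * θ * ∑ i, dist1 (BlockAveraging.loopHol U c i) := by
    have : M ^ 2 ≤ θ * ∑ i, dist1 (BlockAveraging.loopHol U c i) := by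
      rw [sq]; exact mul_le_mul hMθ hMS hM0 ((hM0.trans hMθ))
    linarith
  calc dist1 (BlockAveraging.corr (expMeanLogSU (n := n)) U c)
      ≤ (Fintype.card (BlockAveraging.Idx P) : ℝ)⁻¹ * ∑ i, dist1 (BlockAveraging.loopHol U c i) + 6 * M ^ 2 := h
    _ ≤ (Fintype.card (BlockAveraging.Idx P) : ℝ)⁻¹ * ∑ i, dist1 (BlockAveraging.loopHol U c i) +
        6 * θ * ∑ i, dist1 (BlockAveraging.loopHol U c i) := add_le_add le_rfl h2
    _ = _ := by ring

/-- ★★★ **THE ONE-STEP MEAN LETTER, CHARGEABLE EDITION**: `dist1 (T_c · ū(c)⁻¹) ≤ (|I|⁻¹ + 6θ) · Σ_{(r,σ,σ′) ∈ I} ( Σ_{k<d} dist1 U(∂R_k(r,σ)) + dist1 REORDER(r,σ,σ′) )` under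
`dist1 Wᵢ ≤ θ < δ_N`, `θ ≤ ¼` — every term a loop defect at this bond (legs ∕ reordering loops), the form px12's `π′`-count consumes. [cite: Balaban1987RG1, (0.3)-(0.4) pp.252-253; Balaban1985Averaging, (9) p.19, (19)-(21) p.21-22, (26)-(27) p.22] -/
theorem dist1_axialAvg_mul_avgFun_inv_le_lin_legs (U : GaugeField P j (Matrix.specialUnitaryGroup n ℂ)) (c : PBond P (j + 1)) {θ : ℝ}
    (hθ : ∀ i, dist1 (BlockAveraging.loopHol U c i) ≤ θ) (hθδ : θ < deltaSU n) (hθ4 : θ ≤ 1 / 4) :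
    dist1 (AveragingRT.axialAvg U c * (BlockAveraging.avgFun (expMeanLogSU (n := n)) U c)⁻¹) ≤
      ((Fintype.card (BlockAveraging.Idx P) : ℝ)⁻¹ + 6 * θ) *
        ∑ i : BlockAveraging.Idx P,
          (((List.range P.d).map fun k =>
            dist1 (rect U
              (if 0 ≤ BlockAveraging.off i.1 (((List.finRange P.d).map i.2.1).getD k c.dir)
                then walkEnd (emb c.src) (stairRuns (BlockAveraging.off i.1) (((List.finRange P.d).map i.2.1).take k))
                else walkEnd (emb c.src) (stairRuns (BlockAveraging.off i.1) (((List.finRange P.d).map i.2.1).take (k + 1))))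
              c.dir (((List.finRange P.d).map i.2.1).getD k c.dir) P.L (BlockAveraging.off i.1 (((List.finRange P.d).map i.2.1).getD k c.dir)).natAbs)).sum +
          dist1 (holAt U (walk (emb c.tgt) (stairWord i.2.1 (BlockAveraging.off i.1) ++ wordRev (stairWord i.2.2 (BlockAveraging.off i.1)))))) := by
  have h0 : 0 ≤ θ := (GaugeGroup.dist1_nonneg _).trans (hθ (Classical.arbitrary _))
  rw [dist1_axialAvg_mul_avgFun_inv]
  refine (dist1_corr_le_lin_sum U c hθ hθδ hθ4).trans ?_
  exact mul_le_mul_of_nonneg_left (sum_dist1_loopHol_le U c) (add_nonneg (inv_nonneg.mpr (Nat.cast_nonneg _)) (by linarith))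

end Summit.QuantumFields.YangMills.Theorems.FluctuationComparisonRegPrIntLS2BetaOneStepMeanLetter

end
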